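import Summits.QuantumFields.BalabanUV.Beta.GAN24.RespStepDecay
import Summits.QuantumFields.BalabanUV.Beta.GAN24.FineReadoutSecondDiffDecay
import Summits.QuantumFields.BalabanUV.Beta.GAN24.ContactLambdaCellBound

/-!
# `BalabanUV.Beta.GAN24.RespStepSecondDiff` — binder row G-an2-4 / (CONV-C), route of record «QR-LL» (OWNER `gan24-p1` g25/g26; row (LT) «LAYER TRANSPORT»,
# leaf-01's (F) `LayerPushMoments` / (G)), THE LOCATED INPUT (N1″) IN THE FORM THAT EXISTS — PART 3, THE END: **(N1″)_{1/2} FOR THE DECIMATED COMPOSITE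
# MINIMISER COLUMNS `respStep (Lc^m) (Lc^(m+k+1))` AT EVERY INTERMEDIATE `m`, UNIFORMLY IN `(m, k)`** — unit second differences on the `Lc^m`-lattice are
# `O((L^6·√L)⁻¹)`, `L = Lc^(k+1)` the RELATIVE blocking, with exponential decay on the `L`-block scale (`d = 3`); jointly with (N1) ∧ (N1′) at ONE rate

NOT IN PRINT; OUR PROOF ATTEMPT (of the road; THIS file is [folklore] packaging, the twin of leaf-12's `RespStepDecay` §2–§3 with one more difference: the triangle
inequality over the `M^{d+1}·M` points of an `M`-block contour + the block-label wobble; the analytic CONTENT is PART 2 `FineReadoutSecondDiffDecay.exists_wH_decay_grad_diff2`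
— two-step second differences of Bałaban's minimiser column gain `N^{−3/2}` over (N1), King at `α = ±1/2`).  WHY `√L` AND NOT `L`: the commissioned (N1″) (OWNER W14,
journal l.40496: `K″·(L^{d+4})⁻¹`) is EXPECTED FALSE for mixed directions by `log L` at the codim-2 block faces (PART 1a `FineReadoutSecondDiffSymbol`'s header: continuum
corner computation + scalar toy kit j153041 — not a theorem about `wH`; withdrawn as a target by OWNER RULING R-gan24p1-g26-3, l.40711); `(L^{d+3}·√L)⁻¹` is what E3A's method
delivers, uniformly in `k`, and it keeps (DUH)'s layer sum geometric (ratio `Lc^{−1/2}`).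
HONEST FRAMING (cell contract, verbatim): «discharging `BetaPertH` makes Bałaban's UV stability UNCONDITIONAL — a real constructive-QFT result; it is NOT the continuum
limit and NOT the Clay problem.»  HONEST DEPENDENCY (verbatim): «continuum YM on T⁴ ⇐ BetaPertH ∧ nine spine estimates (0/9 proved); BetaPertH ⇐ (D1) ∧ (D4) ∧ CAP+tail;
G-an2-4 gates asym, D1 and NE2/3/4.»  No cited fact, no wall binder, no `def`, no `def … : Prop`; discharges NOTHING of (LT) ∕ (Q-R) ∕ (Q-L) ∕ (C) ∕ «T2Shape» ∕ (hW, hWall)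
— (N1″)_{1/2} is ONE leg-shape hypothesis (`ha2`/`hb2` of leaf-01's `abs_second_diff_mul_le`, LITERALLY the shape below) of the PURE CELL of (LT-3); NEVER «G-an2-4 closed»
as (CONV-C); NOT D1, NOT `BetaPertH`, NOT continuum, NOT Clay.

## What is proved
* §1 (generic `d`, `N′ = M·L`) **`abs_respStep_diff2_le`** — (N1″)-TYPE SMEARING: a two-step second-difference envelope of the level-`N′` column for the fine steps
  `M•b`, `M•c`, `|wH(v + M•b + M•c) − wH(v + M•b) − wH(v + M•c) + wH(v)| ≤ A″·e^{−κ₀‖quo N′ v‖∞}`, is read by the `M`-block contour as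
  `|respStep(w′ + (b + c)) − respStep(w′ + b) − respStep(w′ + c) + respStep(w′)| ≤ (M^{d+2}·A″·e^{κ₀})·e^{−κ₀‖quo L w′ − z‖∞}` (coarse steps `b, c` = fine shifts
  `M•b, M•c` of every contour point).
* §2 (`d = 3`, every blocking factor `Lc ≥ 1`) **`exists_respStep_decay_grad_diff2`**: ONE rate `κ₀ > 0` and constants `C, C′, C″ ≥ 0` with, for ALL `m k μ z l″ w′ ν ν′`,
  (N1) `|respStep (Lc^m) (Lc^(m+k+1)) μ z l″ w′| ≤ C·((Lc^(k+1))^5)⁻¹·env`, (N1′) `|Δ_ν respStep …| ≤ C′·((Lc^(k+1))^6)⁻¹·env`, and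
  (N1″)_{1/2} `|(respStep … (w′ + e_ν + e_ν′) − respStep … (w′ + e_ν′)) − (respStep … (w′ + e_ν) − respStep … w′)| ≤ C″·((Lc^(k+1))^6·√(Lc^(k+1)))⁻¹·env`,
  `env = e^{−κ₀‖quo (Lc^(k+1)) w′ − z‖∞}` — the power count `M^{d+2}·M√M·(N′^{d+3}·√N′)⁻¹ = (L^{d+3}·√L)⁻¹` is exact, the rate is PART 2's, the constants are OUTSIDE every `∀`
  (`m = 0`: the column itself, `RespStepDecay.respStep_one`).
* §3 **`exists_respStep_decay_grad_diff2_l1`**: the same three clauses with the decay in `ℓ¹` block-label currency `e^{−κ·|quo L w′ − z|₁}` (rate `κ₀/4`; my g49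
  `ContactLambdaCellBound.exp_supNorm_le_exp_l1` BY NAME) = the leg sockets `ha0`/`ha1`/`ha2` of leaf-01's (G) `LayerFrozenCount.abs_cubic_frozen_three_half` TOKEN FOR TOKEN.
Unit `b2b-balaban-gan24-formalise-leaf-02` (G-an2-4 formalisation swarm, leaf prover 02, gen 54; INTENT I-leaf02-g54-1 «N1-TAYLOR», journal l.40624), 2026-08-22.
-/

noncomputable section

open Finset
open scoped BigOperators
open Literature.MathematicalPhysics.QuantumFieldTheory.LatticeForm (quo)
open Literature.MathematicalPhysics.QuantumFieldTheory.Balaban1983to89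
open Literature.MathematicalPhysics.QuantumFieldTheory.Balaban1983to89.Beta
open B12Sec2to5 (l1 l1_nonneg)
open B4ContourShift (supNorm abs_le_supNorm supNorm_nonneg)
open KernelSpecInstance (wH)
open AffineAveraging (contourSum Form1 box toSite unitVec)
open BalabanCompositeJets (respStep)
open ExpKernelCalculus (l1_natSmul)
open Summit.QuantumFields.BalabanUV.Beta.GAN24.RespStepDecay (respStep_eq_sum contour_offset_lt supNorm_quo_sub_le_add exp_wobble card_box_mul_card_range
  abs_respStep_le abs_respStep_sub_le)
open Summit.QuantumFields.BalabanUV.Beta.GAN24.FineReadoutSecondDiffDecay (exists_wH_decay_grad_diff2)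
open Summit.QuantumFields.BalabanUV.Beta.GAN24.ContactLambdaCellBound (exp_supNorm_le_exp_l1)

namespace Summit.QuantumFields.BalabanUV.Beta.GAN24.RespStepSecondDiff

variable {d : ℕ}

/-! ## §1 The smearing lemma for two-step second differences -/

section Smearing

variable {M L N' : ℕ} [NeZero M] [NeZero L] [NeZero N']

/-- [folklore] **(N1″)-TYPE SMEARING**: a two-step second-difference envelope of the level-`N′` minimiser column for the fine steps `M•b`, `M•c`, `N′ = M·L`,
`|wH κ l (v + (M•b + M•c)) − wH κ l (v + M•b) − wH κ l (v + M•c) + wH κ l v| ≤ A″·e^{−κ₀‖quo N′ v‖∞}`, is read by the `M`-block contour as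
`|respStep M N′ μ z l″ (w′ + (b + c)) − respStep … (w′ + b) − respStep … (w′ + c) + respStep … w′| ≤ (M^{d+2}·A″·e^{κ₀})·e^{−κ₀‖quo L w′ − z‖∞}` — the coarse
steps `b, c` of the level-`M` position are the shifts `M•b`, `M•c` of every contour point; `M^{d+1}·M` contour points, each at relative block label `quo L w′ − z` up to one block. -/
theorem abs_respStep_diff2_le (hN : N' = M * L) {A'' κ₀ : ℝ} (hA : 0 ≤ A'') (hκ : 0 ≤ κ₀) (b c : Fin (d + 1) → ℤ)
    (hwH'' : ∀ (κ l : Fin (d + 1)) (v : Fin (d + 1) → ℤ),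
      |wH (N := N') κ l (v + ((M : ℤ) • b + (M : ℤ) • c)) - wH (N := N') κ l (v + (M : ℤ) • b) - wH (N := N') κ l (v + (M : ℤ) • c)
          + wH (N := N') κ l v| ≤ A'' * Real.exp (-(κ₀ * supNorm (quo N' v))))
    (μ : Fin (d + 1)) (z : Fin (d + 1) → ℤ) (l'' : Fin (d + 1)) (w' : Fin (d + 1) → ℤ) :
    |respStep (d := d) M N' μ z l'' (w' + (b + c)) - respStep (d := d) M N' μ z l'' (w' + b) - respStep (d := d) M N' μ z l'' (w' + c)
        + respStep (d := d) M N' μ z l'' w'| ≤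
      ((M : ℝ) ^ (d + 2) * A'' * Real.exp κ₀) * Real.exp (-(κ₀ * supNorm (quo L w' - z))) := by
  subst hN
  rw [respStep_eq_sum, respStep_eq_sum, respStep_eq_sum, respStep_eq_sum, ← Finset.sum_sub_distrib, ← Finset.sum_sub_distrib,
    ← Finset.sum_add_distrib]
  simp only [← Finset.sum_sub_distrib, ← Finset.sum_add_distrib]
  -- the points of the shifted contours are the old points moved by `M•b`, `M•c`, `M•b + M•c`
  have hpt : ∀ (t : Fin (d + 1) → ℤ) (β : Fin (d + 1) → ℕ) (s : ℕ),
      (M : ℤ) • (w' + t) + (toSite β + (s : ℤ) • unitVec l'') - ((M * L : ℕ) : ℤ) • z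
        = ((M : ℤ) • w' + (toSite β + (s : ℤ) • unitVec l'') - ((M * L : ℕ) : ℤ) • z) + (M : ℤ) • t := by
    intro t β s
    rw [smul_add]
    abel
  have hbc : (M : ℤ) • (b + c) = (M : ℤ) • b + (M : ℤ) • c := smul_add _ _ _
  have hterm : ∀ β ∈ box (d + 1) M, ∀ s ∈ Finset.range M,
      |wH (N := M * L) l'' μ ((M : ℤ) • (w' + (b + c)) + (toSite β + (s : ℤ) • unitVec l'') - ((M * L : ℕ) : ℤ) • z)
        - wH (N := M * L) l'' μ ((M : ℤ) • (w' + b) + (toSite β + (s : ℤ) • unitVec l'') - ((M * L : ℕ) : ℤ) • z)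
        - wH (N := M * L) l'' μ ((M : ℤ) • (w' + c) + (toSite β + (s : ℤ) • unitVec l'') - ((M * L : ℕ) : ℤ) • z)
        + wH (N := M * L) l'' μ ((M : ℤ) • w' + (toSite β + (s : ℤ) • unitVec l'') - ((M * L : ℕ) : ℤ) • z)| ≤
        A'' * Real.exp κ₀ * Real.exp (-(κ₀ * supNorm (quo L w' - z))) := by
    intro β hβ s hs
    have hs' : s < M := Finset.mem_range.1 hs
    have hr := fun i => contour_offset_lt (d := d) hβ hs' l'' i
    have hlab := supNorm_quo_sub_le_add M L w' z hr (n := 1)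
    rw [hpt (b + c), hpt b, hpt c, hbc]
    refine (hwH'' l'' μ _).trans ?_
    have hw := exp_wobble hκ hlab
    rw [Nat.cast_one, one_mul] at hw
    calc A'' * Real.exp (-(κ₀ * supNorm (quo (M * L) ((M : ℤ) • w' + (toSite β + (s : ℤ) • unitVec l'') - ((M * L : ℕ) : ℤ) • z))))
        ≤ A'' * (Real.exp κ₀ * Real.exp (-(κ₀ * supNorm (quo L w' - z)))) := mul_le_mul_of_nonneg_left hw hA
      _ = A'' * Real.exp κ₀ * Real.exp (-(κ₀ * supNorm (quo L w' - z))) := by ring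
  calc |∑ β ∈ box (d + 1) M, ∑ s ∈ Finset.range M,
          (wH (N := M * L) l'' μ ((M : ℤ) • (w' + (b + c)) + (toSite β + (s : ℤ) • unitVec l'') - ((M * L : ℕ) : ℤ) • z)
            - wH (N := M * L) l'' μ ((M : ℤ) • (w' + b) + (toSite β + (s : ℤ) • unitVec l'') - ((M * L : ℕ) : ℤ) • z)
            - wH (N := M * L) l'' μ ((M : ℤ) • (w' + c) + (toSite β + (s : ℤ) • unitVec l'') - ((M * L : ℕ) : ℤ) • z)
            + wH (N := M * L) l'' μ ((M : ℤ) • w' + (toSite β + (s : ℤ) • unitVec l'') - ((M * L : ℕ) : ℤ) • z))|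
      ≤ ∑ β ∈ box (d + 1) M, ∑ s ∈ Finset.range M,
          |wH (N := M * L) l'' μ ((M : ℤ) • (w' + (b + c)) + (toSite β + (s : ℤ) • unitVec l'') - ((M * L : ℕ) : ℤ) • z)
            - wH (N := M * L) l'' μ ((M : ℤ) • (w' + b) + (toSite β + (s : ℤ) • unitVec l'') - ((M * L : ℕ) : ℤ) • z)
            - wH (N := M * L) l'' μ ((M : ℤ) • (w' + c) + (toSite β + (s : ℤ) • unitVec l'') - ((M * L : ℕ) : ℤ) • z)
            + wH (N := M * L) l'' μ ((M : ℤ) • w' + (toSite β + (s : ℤ) • unitVec l'') - ((M * L : ℕ) : ℤ) • z)| :=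
        (abs_sum_le_sum_abs _ _).trans (sum_le_sum fun β _ => abs_sum_le_sum_abs _ _)
    _ ≤ ∑ β ∈ box (d + 1) M, ∑ _s ∈ Finset.range M, A'' * Real.exp κ₀ * Real.exp (-(κ₀ * supNorm (quo L w' - z))) :=
        sum_le_sum fun β hβ => sum_le_sum fun s hs => hterm β hβ s hs
    _ = ((M : ℝ) ^ (d + 2) * A'' * Real.exp κ₀) * Real.exp (-(κ₀ * supNorm (quo L w' - z))) := by
        rw [sum_const, sum_const, smul_smul, nsmul_eq_mul, Nat.cast_mul, card_box_mul_card_range]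
        ring

end Smearing

/-! ## §2 `d = 3`: (N1) ∧ (N1′) ∧ (N1″)_{1/2} for the decimated composite columns at every intermediate level, unconditionally -/

section Four

variable {Lc : ℕ} [NeZero Lc]

/-- [folklore] `‖t•e_ν‖₁ = t` for `t ∈ ℕ`. -/
theorem l1_natSmul_single (t : ℕ) (ν : Fin (d + 1)) : l1 ((t : ℤ) • (Pi.single ν 1 : Fin (d + 1) → ℤ)) = t := by
  unfold l1
  rw [Finset.sum_eq_single ν (fun μ _ hμ => by simp [hμ]) (fun h => (h (Finset.mem_univ ν)).elim)]
  simp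

/-- NOT IN PRINT; OUR PROOF ([folklore] packaging of leaf-16's (N1), leaf-19's (N1′) and PART 2's (N1″)_{1/2}, `FineReadoutSecondDiffDecay.exists_wH_decay_grad_diff2` BY NAME).
**(N1) ∧ (N1′) ∧ (N1″)_{1/2} FOR THE DECIMATED COMPOSITE MINIMISER COLUMNS, UNIFORMLY IN THE PAIR OF LEVELS** (`d = 3`, every blocking factor `Lc ≥ 1`): ONE rate
`κ₀ > 0` and constants `C, C′, C″ ≥ 0` such that for ALL `m k` (read-out level `Lc^m`, source level `Lc^(m+k+1)`, relative blocking `L = Lc^(k+1)`), all bonds `(μ, z)`,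
`(l″, w′)` and directions `ν, ν′`: (N1) `≤ C·(L^5)⁻¹·env`, (N1′) `≤ C′·(L^6)⁻¹·env`, and the UNIT SECOND DIFFERENCES
`|(respStep … (w′ + e_ν + e_ν′) − respStep … (w′ + e_ν′)) − (respStep … (w′ + e_ν) − respStep … w′)| ≤ C″·(L^6·√L)⁻¹·e^{−κ₀‖quo L w′ − z‖∞}` — LITERALLY the
hypothesis shape `ha2`/`hb2` of leaf-01's `LayerPushMoments.abs_second_diff_mul_le` for the leg `a = respStep (Lc^m) (Lc^(m+k+1)) μ z l″`, with `ha = C″·(L^6·√L)⁻¹·env`.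
`√L`, not `L`: the mixed second differences of the column are expected to carry `log L` at the block edges (PART 1a's header) — this is the uniform statement E3A's method proves. -/
theorem exists_respStep_decay_grad_diff2 :
    ∃ κ₀ C C' C'' : ℝ, 0 < κ₀ ∧ 0 ≤ C ∧ 0 ≤ C' ∧ 0 ≤ C'' ∧
      (∀ (m k : ℕ) (μ : Fin (3 + 1)) (z : Fin (3 + 1) → ℤ) (l'' : Fin (3 + 1)) (w' : Fin (3 + 1) → ℤ),
        |respStep (d := 3) (Lc ^ m) (Lc ^ (m + k + 1)) μ z l'' w'| ≤
          C * ((((Lc ^ (k + 1) : ℕ) : ℝ)) ^ (3 + 2))⁻¹ * Real.exp (-(κ₀ * supNorm (quo (Lc ^ (k + 1)) w' - z)))) ∧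
      (∀ (m k : ℕ) (μ : Fin (3 + 1)) (z : Fin (3 + 1) → ℤ) (l'' : Fin (3 + 1)) (w' : Fin (3 + 1) → ℤ) (ν : Fin (3 + 1)),
        |respStep (d := 3) (Lc ^ m) (Lc ^ (m + k + 1)) μ z l'' (w' + Pi.single ν 1)
            - respStep (d := 3) (Lc ^ m) (Lc ^ (m + k + 1)) μ z l'' w'| ≤
          C' * ((((Lc ^ (k + 1) : ℕ) : ℝ)) ^ (3 + 3))⁻¹ * Real.exp (-(κ₀ * supNorm (quo (Lc ^ (k + 1)) w' - z)))) ∧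
      (∀ (m k : ℕ) (μ : Fin (3 + 1)) (z : Fin (3 + 1) → ℤ) (l'' : Fin (3 + 1)) (w' : Fin (3 + 1) → ℤ) (ν ν' : Fin (3 + 1)),
        |(respStep (d := 3) (Lc ^ m) (Lc ^ (m + k + 1)) μ z l'' (w' + Pi.single ν 1 + Pi.single ν' 1)
            - respStep (d := 3) (Lc ^ m) (Lc ^ (m + k + 1)) μ z l'' (w' + Pi.single ν' 1))
          - (respStep (d := 3) (Lc ^ m) (Lc ^ (m + k + 1)) μ z l'' (w' + Pi.single ν 1)
            - respStep (d := 3) (Lc ^ m) (Lc ^ (m + k + 1)) μ z l'' w')| ≤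
          C'' * ((((Lc ^ (k + 1) : ℕ) : ℝ)) ^ (3 + 3) * Real.sqrt (((Lc ^ (k + 1) : ℕ) : ℝ)))⁻¹
            * Real.exp (-(κ₀ * supNorm (quo (Lc ^ (k + 1)) w' - z)))) := by
  obtain ⟨κ₀, C, C', C'', hκ₀, hC, hC', hC'', hN1, hN1', hN1''⟩ := exists_wH_decay_grad_diff2 (Lc := Lc)
  have hL : (0 : ℝ) < (Lc : ℝ) := by exact_mod_cast Nat.pos_of_ne_zero (NeZero.ne Lc)
  obtain ⟨_, _, _, -, -, -, hR1, hR1'⟩ : ∃ κ₁ C₁ C₁' : ℝ, 0 < κ₁ ∧ 0 ≤ C₁ ∧ 0 ≤ C₁' ∧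
      (∀ (m k : ℕ) (μ : Fin (3 + 1)) (z : Fin (3 + 1) → ℤ) (l'' : Fin (3 + 1)) (w' : Fin (3 + 1) → ℤ),
        |respStep (d := 3) (Lc ^ m) (Lc ^ (m + k + 1)) μ z l'' w'| ≤
          C * Real.exp κ₀ * ((((Lc ^ (k + 1) : ℕ) : ℝ)) ^ (3 + 2))⁻¹ * Real.exp (-(κ₀ * supNorm (quo (Lc ^ (k + 1)) w' - z)))) ∧
      (∀ (m k : ℕ) (μ : Fin (3 + 1)) (z : Fin (3 + 1) → ℤ) (l'' : Fin (3 + 1)) (w' : Fin (3 + 1) → ℤ) (ν : Fin (3 + 1)),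
        |respStep (d := 3) (Lc ^ m) (Lc ^ (m + k + 1)) μ z l'' (w' + Pi.single ν 1)
            - respStep (d := 3) (Lc ^ m) (Lc ^ (m + k + 1)) μ z l'' w'| ≤
          C' * Real.exp (2 * κ₀) * ((((Lc ^ (k + 1) : ℕ) : ℝ)) ^ (3 + 3))⁻¹ * Real.exp (-(κ₀ * supNorm (quo (Lc ^ (k + 1)) w' - z)))) := by
    refine ⟨κ₀, C * Real.exp κ₀, C' * Real.exp (2 * κ₀), hκ₀, by positivity, by positivity, fun m k μ z l'' w' => ?_,
      fun m k μ z l'' w' ν => ?_⟩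
    · have hN : Lc ^ (m + k + 1) = Lc ^ m * Lc ^ (k + 1) := by rw [← pow_add, add_assoc]
      have hA : 0 ≤ C * ((((Lc ^ (m + k + 1) : ℕ) : ℝ)) ^ (3 + 2))⁻¹ := by positivity
      have h := abs_respStep_le (d := 3) (M := Lc ^ m) (L := Lc ^ (k + 1)) hN hA hκ₀.le (fun κ l v => hN1 (m + k) κ l v) μ z l'' w'
      refine h.trans (le_of_eq ?_)
      have e : (((Lc ^ m : ℕ) : ℝ)) ^ (3 + 2) * ((((Lc ^ (m + k + 1) : ℕ) : ℝ)) ^ (3 + 2))⁻¹ = ((((Lc ^ (k + 1) : ℕ) : ℝ)) ^ (3 + 2))⁻¹ := by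
        push_cast
        rw [show (Lc : ℝ) ^ (m + k + 1) = (Lc : ℝ) ^ m * (Lc : ℝ) ^ (k + 1) by rw [← pow_add, add_assoc], mul_pow, mul_inv,
          ← mul_assoc, mul_inv_cancel₀ (by positivity), one_mul]
      calc (((Lc ^ m : ℕ) : ℝ)) ^ (3 + 2) * (C * ((((Lc ^ (m + k + 1) : ℕ) : ℝ)) ^ (3 + 2))⁻¹) * Real.exp κ₀ *
            Real.exp (-(κ₀ * supNorm (quo (Lc ^ (k + 1)) w' - z)))
          = C * Real.exp κ₀ * ((((Lc ^ m : ℕ) : ℝ)) ^ (3 + 2) * ((((Lc ^ (m + k + 1) : ℕ) : ℝ)) ^ (3 + 2))⁻¹) *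
            Real.exp (-(κ₀ * supNorm (quo (Lc ^ (k + 1)) w' - z))) := by ring
        _ = _ := by rw [e]
    · have hN : Lc ^ (m + k + 1) = Lc ^ m * Lc ^ (k + 1) := by rw [← pow_add, add_assoc]
      have hA : 0 ≤ C' * ((((Lc ^ (m + k + 1) : ℕ) : ℝ)) ^ (3 + 3))⁻¹ := by positivity
      have h := abs_respStep_sub_le (d := 3) (M := Lc ^ m) (L := Lc ^ (k + 1)) hN hA hκ₀.le (fun κ l v ν => hN1' (m + k) κ l v ν) μ z l'' w' ν
      refine h.trans (le_of_eq ?_)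
      have e : (((Lc ^ m : ℕ) : ℝ)) ^ (3 + 2) * (((Lc ^ m : ℕ) : ℝ)) * ((((Lc ^ (m + k + 1) : ℕ) : ℝ)) ^ (3 + 3))⁻¹
          = ((((Lc ^ (k + 1) : ℕ) : ℝ)) ^ (3 + 3))⁻¹ := by
        push_cast
        rw [show (Lc : ℝ) ^ (m + k + 1) = (Lc : ℝ) ^ m * (Lc : ℝ) ^ (k + 1) by rw [← pow_add, add_assoc], mul_pow, mul_inv,
          show ((Lc : ℝ) ^ m) ^ (3 + 2) * (Lc : ℝ) ^ m = ((Lc : ℝ) ^ m) ^ (3 + 3) by ring,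
          ← mul_assoc, mul_inv_cancel₀ (by positivity), one_mul]
      calc (((Lc ^ m : ℕ) : ℝ)) ^ (3 + 2) * (((Lc ^ m : ℕ) : ℝ)) * (C' * ((((Lc ^ (m + k + 1) : ℕ) : ℝ)) ^ (3 + 3))⁻¹) *
            Real.exp (2 * κ₀) * Real.exp (-(κ₀ * supNorm (quo (Lc ^ (k + 1)) w' - z)))
          = C' * Real.exp (2 * κ₀) *
            ((((Lc ^ m : ℕ) : ℝ)) ^ (3 + 2) * (((Lc ^ m : ℕ) : ℝ)) * ((((Lc ^ (m + k + 1) : ℕ) : ℝ)) ^ (3 + 3))⁻¹) *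
            Real.exp (-(κ₀ * supNorm (quo (Lc ^ (k + 1)) w' - z))) := by ring
        _ = _ := by rw [e]
  refine ⟨κ₀, C * Real.exp κ₀, C' * Real.exp (2 * κ₀), C'' * Real.exp (1 / 2) * Real.exp κ₀, hκ₀, by positivity, by positivity, by positivity,
    hR1, hR1', fun m k μ z l'' w' ν ν' => ?_⟩
  -- (N1″)_{1/2} at blocking `N′ = Lc^(m+k+1) = Lc^m · Lc^(k+1)`, steps `M•e_ν`, `M•e_ν′`: envelope `A″ = C″·√M·M·e^{1/2}·(N′^6·√N′)⁻¹`
  have hN : Lc ^ (m + k + 1) = Lc ^ m * Lc ^ (k + 1) := by rw [← pow_add, add_assoc]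
  haveI : NeZero (Lc ^ (m + k + 1)) := ⟨pow_ne_zero _ (NeZero.ne Lc)⟩
  set M : ℕ := Lc ^ m with hM
  set N' : ℕ := Lc ^ (m + k + 1) with hN'
  set Y : ℝ := (((Lc ^ (k + 1) : ℕ) : ℝ)) with hY
  have hMpos : (0 : ℝ) < (M : ℝ) := by rw [hM]; exact_mod_cast pow_pos (Nat.pos_of_ne_zero (NeZero.ne Lc)) m
  have hY1 : (1 : ℝ) ≤ Y := by rw [hY]; exact_mod_cast Nat.one_le_iff_ne_zero.2 (pow_ne_zero _ (NeZero.ne Lc))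
  have hYpos : (0 : ℝ) < Y := lt_of_lt_of_le one_pos hY1
  have hcast : ((N' : ℕ) : ℝ) = (M : ℝ) * Y := by rw [hN, Nat.cast_mul]
  have hN'pos : (0 : ℝ) < (N' : ℝ) := by rw [hcast]; positivity
  have hMN : (M : ℝ) ≤ (N' : ℝ) := by rw [hcast]; exact le_mul_of_one_le_right hMpos.le hY1
  set A'' : ℝ := C'' * (Real.sqrt M * M * Real.exp (1 / 2)) * (((N' : ℝ)) ^ (3 + 3) * Real.sqrt (N' : ℝ))⁻¹ with hA''
  have hA0 : 0 ≤ A'' := by positivity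
  have henv : ∀ (κ l : Fin (3 + 1)) (v : Fin (3 + 1) → ℤ),
      |wH (N := N') κ l (v + ((M : ℤ) • (Pi.single ν 1 : Fin (3 + 1) → ℤ) + (M : ℤ) • (Pi.single ν' 1 : Fin (3 + 1) → ℤ)))
          - wH (N := N') κ l (v + (M : ℤ) • (Pi.single ν 1 : Fin (3 + 1) → ℤ))
          - wH (N := N') κ l (v + (M : ℤ) • (Pi.single ν' 1 : Fin (3 + 1) → ℤ)) + wH (N := N') κ l v|
        ≤ A'' * Real.exp (-(κ₀ * supNorm (quo N' v))) := by
    intro κ l v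
    have h := hN1'' (m + k) κ l v ((M : ℤ) • (Pi.single ν 1 : Fin (3 + 1) → ℤ)) ((M : ℤ) • (Pi.single ν' 1 : Fin (3 + 1) → ℤ))
    rw [l1_natSmul_single, l1_natSmul_single] at h
    refine h.trans ?_
    have hstep : Real.exp (((M : ℝ) + M) / (4 * (N' : ℝ))) ≤ Real.exp (1 / 2) := by
      apply Real.exp_le_exp.2
      rw [div_le_iff₀ (by positivity)]
      linarith
    have h1 : C'' * (Real.sqrt M * M * Real.exp (((M : ℝ) + M) / (4 * (N' : ℝ)))) ≤ C'' * (Real.sqrt M * M * Real.exp (1 / 2)) :=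
      mul_le_mul_of_nonneg_left (mul_le_mul_of_nonneg_left hstep (by positivity)) hC''
    calc C'' * (Real.sqrt M * M * Real.exp (((M : ℝ) + M) / (4 * (N' : ℝ)))) * (((N' : ℝ)) ^ (3 + 3) * Real.sqrt (N' : ℝ))⁻¹
          * Real.exp (-(κ₀ * supNorm (quo N' v)))
        ≤ C'' * (Real.sqrt M * M * Real.exp (1 / 2)) * (((N' : ℝ)) ^ (3 + 3) * Real.sqrt (N' : ℝ))⁻¹ * Real.exp (-(κ₀ * supNorm (quo N' v))) := by
          apply mul_le_mul_of_nonneg_right _ (Real.exp_pos _).le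
          exact mul_le_mul_of_nonneg_right h1 (by positivity)
      _ = A'' * Real.exp (-(κ₀ * supNorm (quo N' v))) := by rw [hA'']
  have h := abs_respStep_diff2_le (d := 3) (M := M) (L := Lc ^ (k + 1)) hN hA0 hκ₀.le (Pi.single ν 1) (Pi.single ν' 1) henv μ z l'' w'
  have hassoc : w' + Pi.single ν 1 + Pi.single ν' 1 = w' + ((Pi.single ν 1 : Fin (3 + 1) → ℤ) + Pi.single ν' 1) := add_assoc _ _ _
  rw [hassoc, show ∀ a b c e : ℝ, (a - c) - (b - e) = a - b - c + e from fun a b c e => by ring]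
  refine h.trans (le_of_eq ?_)
  -- the power count: `M^5 · (√M·M) · (N′^6·√N′)⁻¹ = (L^6·√L)⁻¹`
  have hsq : Real.sqrt (N' : ℝ) = Real.sqrt M * Real.sqrt Y := by rw [hcast, Real.sqrt_mul hMpos.le]
  have hsM : Real.sqrt (M : ℝ) ≠ 0 := (Real.sqrt_pos.2 hMpos).ne'
  have hsY : Real.sqrt Y ≠ 0 := (Real.sqrt_pos.2 hYpos).ne'
  have hM0 : (M : ℝ) ≠ 0 := hMpos.ne'
  have hY0 : Y ≠ 0 := hYpos.ne'
  have e : ((M : ℝ)) ^ (3 + 2) * (Real.sqrt M * M) * (((N' : ℝ)) ^ (3 + 3) * Real.sqrt (N' : ℝ))⁻¹ = (Y ^ (3 + 3) * Real.sqrt Y)⁻¹ := by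
    rw [hsq, hcast]
    field_simp
    ring
  calc ((M : ℝ)) ^ (3 + 2) * A'' * Real.exp κ₀ * Real.exp (-(κ₀ * supNorm (quo (Lc ^ (k + 1)) w' - z)))
      = C'' * Real.exp (1 / 2) * Real.exp κ₀ * (((M : ℝ)) ^ (3 + 2) * (Real.sqrt M * M) * (((N' : ℝ)) ^ (3 + 3) * Real.sqrt (N' : ℝ))⁻¹)
          * Real.exp (-(κ₀ * supNorm (quo (Lc ^ (k + 1)) w' - z))) := by rw [hA'']; ring
    _ = _ := by rw [e]

/-! ## §3 The same in `ℓ¹` block-label currency — LITERALLY the sockets `ha0`/`ha1`/`ha2` of leaf-01's (G) `LayerFrozenCount.abs_cubic_frozen_three_half` -/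

/-- NOT IN PRINT; OUR PROOF ([folklore] rate adapter `e^{−κ₀‖v‖∞} ≤ e^{−(κ₀/(d+1))|v|₁}`, my g49 `ContactLambdaCellBound.exp_supNorm_le_exp_l1` BY NAME).
**(N1) ∧ (N1′) ∧ (N1″)_{1/2} FOR THE DECIMATED COMPOSITE COLUMNS IN `ℓ¹` CURRENCY** (`d = 3`): ONE rate `κ > 0` (a quarter of §2's) and the same three constants, with the
decay written `e^{−κ·|quo L w′ − z|₁}` — for the leg `a := respStep (Lc^m) (Lc^(m+k+1)) μ z l″`, `L := Lc^(k+1)`, `cU := z` these are the three leg hypotheses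
`ha0`/`ha1`/`ha2` (and `hb·`, `hc·`) of leaf-01 g64's `LayerFrozenCount.abs_cubic_frozen_three_half` (v2, staged 1247f88402111394) token for token, `A := C`,
`A′ := C′`, `A″ := C″`. -/
theorem exists_respStep_decay_grad_diff2_l1 :
    ∃ κ C C' C'' : ℝ, 0 < κ ∧ 0 ≤ C ∧ 0 ≤ C' ∧ 0 ≤ C'' ∧
      (∀ (m k : ℕ) (μ : Fin (3 + 1)) (z : Fin (3 + 1) → ℤ) (l'' : Fin (3 + 1)) (w' : Fin (3 + 1) → ℤ),
        |respStep (d := 3) (Lc ^ m) (Lc ^ (m + k + 1)) μ z l'' w'| ≤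
          C * ((((Lc ^ (k + 1) : ℕ) : ℝ)) ^ (3 + 2))⁻¹ * Real.exp (-κ * l1 (quo (Lc ^ (k + 1)) w' - z))) ∧
      (∀ (m k : ℕ) (μ : Fin (3 + 1)) (z : Fin (3 + 1) → ℤ) (l'' : Fin (3 + 1)) (w' : Fin (3 + 1) → ℤ) (ν : Fin (3 + 1)),
        |respStep (d := 3) (Lc ^ m) (Lc ^ (m + k + 1)) μ z l'' (w' + Pi.single ν 1)
            - respStep (d := 3) (Lc ^ m) (Lc ^ (m + k + 1)) μ z l'' w'| ≤
          C' * ((((Lc ^ (k + 1) : ℕ) : ℝ)) ^ (3 + 3))⁻¹ * Real.exp (-κ * l1 (quo (Lc ^ (k + 1)) w' - z))) ∧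
      (∀ (m k : ℕ) (μ : Fin (3 + 1)) (z : Fin (3 + 1) → ℤ) (l'' : Fin (3 + 1)) (w' : Fin (3 + 1) → ℤ) (ν ν' : Fin (3 + 1)),
        |(respStep (d := 3) (Lc ^ m) (Lc ^ (m + k + 1)) μ z l'' (w' + Pi.single ν 1 + Pi.single ν' 1)
            - respStep (d := 3) (Lc ^ m) (Lc ^ (m + k + 1)) μ z l'' (w' + Pi.single ν' 1))
          - (respStep (d := 3) (Lc ^ m) (Lc ^ (m + k + 1)) μ z l'' (w' + Pi.single ν 1)
            - respStep (d := 3) (Lc ^ m) (Lc ^ (m + k + 1)) μ z l'' w')| ≤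
          C'' * ((((Lc ^ (k + 1) : ℕ) : ℝ)) ^ (3 + 3) * Real.sqrt (((Lc ^ (k + 1) : ℕ) : ℝ)))⁻¹
            * Real.exp (-κ * l1 (quo (Lc ^ (k + 1)) w' - z))) := by
  obtain ⟨κ₀, C, C', C'', hκ₀, hC, hC', hC'', h0, h1, h2⟩ := exists_respStep_decay_grad_diff2 (Lc := Lc)
  have hrate : ∀ v : Fin (3 + 1) → ℤ, Real.exp (-(κ₀ * supNorm v)) ≤ Real.exp (-(κ₀ / ((3 : ℝ) + 1)) * l1 v) := fun v => by
    have h := exp_supNorm_le_exp_l1 (d := 3) hκ₀.le v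
    push_cast at h
    exact h
  refine ⟨κ₀ / ((3 : ℝ) + 1), C, C', C'', by positivity, hC, hC', hC'', fun m k μ z l'' w' => ?_, fun m k μ z l'' w' ν => ?_,
    fun m k μ z l'' w' ν ν' => ?_⟩
  · exact (h0 m k μ z l'' w').trans (mul_le_mul_of_nonneg_left (hrate _) (by positivity))
  · exact (h1 m k μ z l'' w' ν).trans (mul_le_mul_of_nonneg_left (hrate _) (by positivity))
  · exact (h2 m k μ z l'' w' ν ν').trans (mul_le_mul_of_nonneg_left (hrate _) (by positivity))

end Four

end Summit.QuantumFields.BalabanUV.Beta.GAN24.RespStepSecondDiff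

end
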